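import Summits.QuantumFields.BalabanUV.Beta.CompositeCorrectorKernel
import Summits.QuantumFields.BalabanUV.Beta.BorderedHessianBlind

/-!
# `BalabanUV.Beta.CompositeCorrectorBordered` — binder row D1, work item K-U3d leaf L4b: **THE ENTRIES OF THE RE-LINEARISED BORDERED OPERATOR
# `Φ̂_mᵀ ∘ bhK (L^m) ∘ Φ̂_m`** (the row-D1 owner's `bhKcomp r L m`, defined BY CONGRUENCE in L4): field–field block = the (windowed) matrix of `d*d` UNCHANGED,
# multiplier–field block = `[proj x = 0]·(compLinAvgAt r L m δ_{(β,z)})_κ(x∕n)` (the straight row `𝒬_n` of `bhK` RE-LINEARISED to the COMPOSITE averaging), field–multiplier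
# block = minus its transpose, multiplier–multiplier block `0` (β sub-cell, BINDER-OWNERS row D1; cross-lane idle seat `b2b-balaban-t4-ne9-formalise-leaf-09` gen 39 on the
# row-D1 OWNER an2-g24's leaf list `HOME/b2b-balaban-beta-an2/gen24/K-U3d-LEAVES.v1.3205b2870f6492d5.md` §L3 third item, RE-CUT to the optional leaf «L4b» by the owner's
# ADDENDUM journal l.24201 «needed by the future `JcComp` def to READ the re-linearised border, not by the `RelInv` END … over `BorderedHessianKernelAction`'s action lemmas»)

HONEST FRAMING (cell charter, verbatim): «discharging BetaPertH makes Balaban's UV stability UNCONDITIONAL — a real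
constructive-QFT result; it is NOT the continuum limit and NOT the Clay problem.»
HONEST DEPENDENCY: continuum YM on T⁴ ⇐ BetaPertH ∧ nine spine estimates (0/9 proved); BetaPertH ⇐ (D1) ∧ (D4) ∧ CAP+tail;
G-an2-4 gates asym, D1 and NE2/3/4.
ABSOLUTE RULE (cell, verbatim): «No internally-minted statement may enter as a cited fact. Every hypothesis is either kernel-proved in this
package or a verbatim quotation of a PUBLISHED theorem with page reference. The manuscript(s) under audit are NOT citable for their own
disputed steps — they are the thing under adjudication; programme-internal (2001/route/tribunal) claims are never citable.»
NOTHING below is cited: no `[cite: …]`, no `def`, no `Prop` fact.  Every declaration is [folklore] finite-sum kernel bookkeeping over the cell's OWN typed objects BY NAME: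
an2's `BorderedHessianKernel.bhK` with `BorderedHessianKernelAction.comp_bhK_inl ∕ comp_bhK_inr ∕ tsum_bhK_inl_inl ∕ tsum_bhK_inr_inl ∕ bhK_inl_inl_eq` (THE ACTION LEMMAS),
`BorderedHessianSymmetry.curvAdj_curv_delta1_symm ∕ contourSum_delta1_eq_contourSumAdj` (matrix symmetry of `d*d`, duality `𝒬 ↔ 𝒬ᵀ`), `BorderedHessianBlind.contourSumAdj_zero`,
`AxialDressingRooted.tsum_point ∕ tsum_point'`; the row-D1 owner's L1 `CompositeCorrectorForms.curv_corrPhi` (FLATNESS) and `contourSum_corrPhi` (RE-LINEARISATION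
`contourSum (L^m) (Φ_m A) = compLinAvgAt r L m A`); leaf-06-g32's L2 `CompositeCorrectorKernel.phiK ∕ indR` with entry lemmas; `KKTFluctuationKernel.delta1`.
It asserts nothing about Bałaban's non-linear averages beyond their typed linearisations.

WHY (row-D1 owner an2-g24, K-U3d-LEAVES v1 §L3 «`trK_phiK_bhK_phiK` — RE-LINEARISED BORDERED OPERATOR … fine block unchanged by `curv_corrPhi`, border by `contourSum_corrPhi`;
sign `−𝒬ᵀ` as in `bhK`» + ADDENDUM l.24201).  The `RelInv` END (L4) treats `Φ̂ᵀ ∘ bhK ∘ Φ̂` as an opaque congruence; the future `JcComp` definition must READ its blocks.  THIS FILE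
reads them, termwise and WITHOUT any re-association of `comp` (no summability is used: the rows of `bhK` are finitely supported — an2's action lemmas — and the multiplier
block of `Φ̂` is the identity with vanishing mixed blocks).

WHAT (`d+1` the lattice dimension; `L` the block side, `m` levels, `n = L^m`; the root offsets `r` are FREE here; `0 < L` only where `contourSum_corrPhi` is used; all [folklore]):
§0 `indR_eq_delta1` (L2's real bond indicator IS `delta1`).
§1 termwise actions: `comp_trK_phiK_inl_left` (`(Φ̂ᵀ∘K)(x,z)_{inl α,b} = Σ'_y Σ_l (Φ_m δ_{(α,x)})_l(y)·K(y,z)_{inl l,b}`), `comp_trK_phiK_inr_left`, `comp_phiK_inr_right` (multiplier rows ∕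
   columns are picked); `comp_trK_phiK_bhK_inl_inl` (field block of `Φ̂ᵀ∘bhK` = that of `bhK`), `comp_comp_trK_phiK_bhK_phiK_inl` (field columns of the sandwich = those of `bhK∘Φ̂`),
   `comp_bhK_phiK_inl_inl` (`= (d*d δ_{(β,z)})_κ(x)`), `comp_bhK_phiK_inr_inl` (`= [proj x = 0]·(compLinAvgAt r L m δ_{(β,z)})_κ(x∕n)`), `comp_trK_phiK_bhK_inl_inr`.
§3 THE FOUR ENTRIES **`trK_phiK_bhK_phiK_inl_inl ∕ _inr_inl ∕ _inl_inr ∕ _inr_inr`** of `comp (comp (trK (phiK r L m)) (bhK (L^m))) (phiK r L m)`.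
Provenance: β sub-cell; cross-lane idle seat `b2b-balaban-t4-ne9-formalise-leaf-09` gen 39 (prover-b2b-balaban-t4-ne9-formalise-leaf-09-g39-0), 2026-08-21 (INTENT journal
l.24020).  NOT (SDF), NOT D1, NOT `BetaPertH`, NOT continuum, NOT Clay.
-/

namespace Summit.QuantumFields.BalabanUV.Beta.CompositeCorrectorBordered

open Finset
open scoped BigOperators
open Literature.Probability.LatticeModels (Torus.proj)
open Literature.MathematicalPhysics.QuantumFieldTheory
open Literature.MathematicalPhysics.QuantumFieldTheory.Balaban1983to89
open Literature.MathematicalPhysics.QuantumFieldTheory.Balaban1983to89.Beta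
open ExpKernelCalculus (MKer comp)
open AffineAveraging (Form0 Form1 Form2 box toSite unitVec dz curv curvAdj contourSum)
open AffineReproduction (contourSumAdj)
open LatticeForm (quo)
open KKTFluctuationKernel (delta1 delta1_apply)
open OneStepResolventKernel (Fib)
open Summit.QuantumFields.BalabanUV.Beta.TameKernelCalculus
open Summit.QuantumFields.BalabanUV.Beta.AxialDressingRooted (cube tsum_point tsum_point')
open Summit.QuantumFields.BalabanUV.Beta.BorderedHessian (bhK bhK_inl_inl bhK_inl_inr bhK_inr_inl bhK_inr_inr bhK_inl_inl_eq fcol mcol fcol_apply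
  mcol_apply comp_bhK_inl comp_bhK_inr tsum_bhK_inl_inl tsum_bhK_inr_inl curvAdj_curv_delta1_symm contourSum_delta1_eq_contourSumAdj
  contourSumAdj_zero)
open Summit.QuantumFields.BalabanUV.Beta.CompositeAveragingCoarseExact (compLinAvgAt)
open Summit.QuantumFields.BalabanUV.Beta.CompositeCorrectorForms (corrPhi contourSum_corrPhi curv_corrPhi)
open Summit.QuantumFields.BalabanUV.Beta.CompositeCorrectorKernel (indR phiK indR_apply phiK_inl_inl phiK_inl_inr phiK_inr_inl phiK_inr_inr)

noncomputable section

variable {d : ℕ}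

/-! ## §0 The indicator of L2 is the delta force of the bordered kernels -/

/-- [folklore] `indR β y = δ_{(β,y)}` (L2's real bond indicator IS `KKTFluctuationKernel.delta1`). -/
theorem indR_eq_delta1 (β : Fin (d + 1)) (y : Fin (d + 1) → ℤ) : indR β y = delta1 β y := by
  funext κ z
  rw [indR_apply, delta1_apply]

/-! ## §1 Termwise actions (no summability, no re-association) -/

section Bordered

variable (r : ℕ → (Fin (d + 1) → ℕ)) (L m : ℕ)

/-! ### The left action of `Φ̂_mᵀ` and the multiplier columns of `· ∘ Φ̂_m` (termwise; no summability) -/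

/-- [folklore] LEFT ACTION OF `Φ̂_mᵀ`, FIELD ROWS: `(Φ̂ᵀ ∘ K)(x,z)_{inl α, b} = Σ'_y Σ_l (Φ_m δ_{(α,x)})_l(y) · K(y,z)_{inl l, b}` (the multiplier
entries of the row of `Φ̂ᵀ` vanish). -/
theorem comp_trK_phiK_inl_left (K : MKer (d + 1) (Fib d)) (x z : Fin (d + 1) → ℤ) (α : Fin (d + 1)) (b : Fib d) :
    comp (trK (phiK r L m)) K x z (Sum.inl α) b = ∑' y, ∑ l : Fin (d + 1), corrPhi r L m (indR α x) l y * K y z (Sum.inl l) b := by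
  unfold ExpKernelCalculus.comp
  refine tsum_congr fun y => ?_
  rw [Fintype.sum_sum_type]
  simp only [trK_apply, phiK_inl_inl, phiK_inr_inl, zero_mul, Finset.sum_const_zero, add_zero]

/-- [folklore] LEFT ACTION OF `Φ̂_mᵀ`, MULTIPLIER ROWS: the row is picked (`Φ̂`'s multiplier block is the identity, its mixed blocks vanish). -/
theorem comp_trK_phiK_inr_left (K : MKer (d + 1) (Fib d)) (x z : Fin (d + 1) → ℤ) (μ : Fin (d + 1)) (b : Fib d) :
    comp (trK (phiK r L m)) K x z (Sum.inr μ) b = K x z (Sum.inr μ) b := by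
  unfold ExpKernelCalculus.comp
  have e : ∀ y, ∑ f : Fib d, trK (phiK r L m) x y (Sum.inr μ) f * K y z f b = if x = y then K y z (Sum.inr μ) b else 0 := by
    intro y
    rw [Fintype.sum_sum_type]
    simp only [trK_apply, phiK_inl_inr, zero_mul, Finset.sum_const_zero, zero_add, phiK_inr_inr]
    rw [Finset.sum_eq_single μ (fun μ' _ hμ' => by rw [if_neg (fun h => hμ' h.2), zero_mul]) (fun h => absurd (Finset.mem_univ μ) h)]
    by_cases hy : x = y
    · rw [if_pos ⟨hy.symm, rfl⟩, one_mul, if_pos hy]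
    · rw [if_neg (fun h => hy h.1.symm), zero_mul, if_neg hy]
  simp_rw [e]
  exact tsum_point x _

/-- [folklore] MULTIPLIER COLUMNS OF `K ∘ Φ̂_m`: the column is picked. -/
theorem comp_phiK_inr_right (K : MKer (d + 1) (Fib d)) (x z : Fin (d + 1) → ℤ) (a : Fib d) (μ : Fin (d + 1)) :
    comp K (phiK r L m) x z a (Sum.inr μ) = K x z a (Sum.inr μ) := by
  unfold ExpKernelCalculus.comp
  have e : ∀ y, ∑ f : Fib d, K x y a f * phiK r L m y z f (Sum.inr μ) = if y = z then K x y a (Sum.inr μ) else 0 := by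
    intro y
    rw [Fintype.sum_sum_type]
    simp only [phiK_inl_inr, mul_zero, Finset.sum_const_zero, zero_add, phiK_inr_inr]
    rw [Finset.sum_eq_single μ (fun μ' _ hμ' => by rw [if_neg (fun h => hμ' h.2), mul_zero]) (fun h => absurd (Finset.mem_univ μ) h)]
    by_cases hy : y = z
    · rw [if_pos ⟨hy, rfl⟩, mul_one, if_pos hy]
    · rw [if_neg (fun h => hy h.1), mul_zero, if_neg hy]
  simp_rw [e]
  rw [tsum_point' z (fun y => K x y a (Sum.inr μ))]

/-! ### The field rows of `Φ̂_mᵀ ∘ bhK (L^m)` and the field columns of the sandwich (no `0 < L` needed) -/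

/-- [folklore] Field–field entry of `Φ̂_mᵀ ∘ bhK`: UNCHANGED — by the matrix symmetry of `d*d` the row sum is the COLUMN sum of `bhK ∘ Φ̂_m` at the
transposed indices, i.e. `(d*d (Φ_m δ_{(α,x)}))_β(z) = (d*d δ_{(α,x)})_β(z) = (d*d δ_{(β,z)})_α(x)`. -/
theorem comp_trK_phiK_bhK_inl_inl (x z : Fin (d + 1) → ℤ) (α β : Fin (d + 1)) :
    comp (trK (phiK r L m)) (bhK (L ^ m)) x z (Sum.inl α) (Sum.inl β) = bhK (L ^ m) x z (Sum.inl α) (Sum.inl β) := by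
  rw [comp_trK_phiK_inl_left]
  have e : ∀ y, ∑ l : Fin (d + 1), corrPhi r L m (indR α x) l y * bhK (L ^ m) y z (Sum.inl l) (Sum.inl β) =
      ∑ l : Fin (d + 1), bhK (L ^ m) z y (Sum.inl β) (Sum.inl l) * phiK r L m y x (Sum.inl l) (Sum.inl α) := by
    intro y
    refine Finset.sum_congr rfl fun l _ => ?_
    rw [bhK_inl_inl_eq, curvAdj_curv_delta1_symm, ← bhK_inl_inl_eq (L ^ m) z y β l, phiK_inl_inl, mul_comm]
  simp_rw [e]
  have hf : fcol (phiK r L m) x (Sum.inl α) = corrPhi r L m (indR α x) := by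
    funext l y; rw [fcol_apply, phiK_inl_inl]
  rw [tsum_bhK_inl_inl, hf, curv_corrPhi, indR_eq_delta1, curvAdj_curv_delta1_symm, ← bhK_inl_inl_eq]

/-- [folklore] The field columns of `(Φ̂_mᵀ ∘ bhK) ∘ Φ̂_m` are those of `bhK ∘ Φ̂_m`: the rows of `Φ̂_mᵀ ∘ bhK` and of `bhK` agree on the FIELD entries
(`comp_trK_phiK_bhK_inl_inl`, `comp_trK_phiK_inr_left`), and the multiplier entries meet the vanishing block `Φ̂_{mf} = 0` — termwise, no re-association. -/
theorem comp_comp_trK_phiK_bhK_phiK_inl (x z : Fin (d + 1) → ℤ) (a : Fib d) (β : Fin (d + 1)) :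
    comp (comp (trK (phiK r L m)) (bhK (L ^ m))) (phiK r L m) x z a (Sum.inl β) = comp (bhK (L ^ m)) (phiK r L m) x z a (Sum.inl β) := by
  unfold ExpKernelCalculus.comp
  refine tsum_congr fun y => ?_
  rw [Fintype.sum_sum_type, Fintype.sum_sum_type]
  simp only [phiK_inr_inl, mul_zero, Finset.sum_const_zero, add_zero]
  refine Finset.sum_congr rfl fun l _ => ?_
  rcases a with α | μ
  · show comp (trK (phiK r L m)) (bhK (L ^ m)) x y (Sum.inl α) (Sum.inl l) * _ = _
    rw [comp_trK_phiK_bhK_inl_inl r L m]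
  · show comp (trK (phiK r L m)) (bhK (L ^ m)) x y (Sum.inr μ) (Sum.inl l) * _ = _
    rw [comp_trK_phiK_inr_left]

/-! ### The columns of `bhK (L^m) ∘ Φ̂_m` -/

variable {L} (hL : 0 < L)
include hL

/-- [folklore] Field–field entry of `bhK ∘ Φ̂_m`: UNCHANGED (`d*d` is `curv`-flat against the corrector: L1 `curv_corrPhi`). -/
theorem comp_bhK_phiK_inl_inl (x z : Fin (d + 1) → ℤ) (κ β : Fin (d + 1)) :
    comp (bhK (L ^ m)) (phiK r L m) x z (Sum.inl κ) (Sum.inl β) = curvAdj (curv (delta1 β z)) κ x := by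
  haveI : NeZero (L ^ m) := ⟨(pow_pos hL m).ne'⟩
  have hf : fcol (phiK r L m) z (Sum.inl β) = corrPhi r L m (indR β z) := by
    funext l y; rw [fcol_apply, phiK_inl_inl]
  have hm : mcol (L ^ m) (phiK r L m) z (Sum.inl β) = 0 := by
    funext l y'; rw [mcol_apply, phiK_inr_inl]; rfl
  rw [comp_bhK_inl, hf, hm, curv_corrPhi, indR_eq_delta1, contourSumAdj_zero, Pi.zero_apply, Pi.zero_apply, sub_zero]

/-- [folklore] Multiplier–field entry of `bhK ∘ Φ̂_m`: THE RE-LINEARISED BORDER `[proj x = 0]·(compLinAvgAt r L m δ_{(β,z)})_κ(x∕n)` (L1 `contourSum_corrPhi`). -/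
theorem comp_bhK_phiK_inr_inl (x z : Fin (d + 1) → ℤ) (κ β : Fin (d + 1)) :
    comp (bhK (L ^ m)) (phiK r L m) x z (Sum.inr κ) (Sum.inl β) =
      if Torus.proj (L ^ m) x = 0 then compLinAvgAt r L m (delta1 β z) κ (quo (L ^ m) x) else 0 := by
  haveI : NeZero (L ^ m) := ⟨(pow_pos hL m).ne'⟩
  have hf : fcol (phiK r L m) z (Sum.inl β) = corrPhi r L m (indR β z) := by
    funext l y; rw [fcol_apply, phiK_inl_inl]
  rw [comp_bhK_inr, hf, contourSum_corrPhi hL, indR_eq_delta1]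

/-! ### The rows of `Φ̂_mᵀ ∘ bhK (L^m)` -/

/-- [folklore] Field–multiplier entry of `Φ̂_mᵀ ∘ bhK`: THE RE-LINEARISED BORDER (transposed, with the sign of `−𝒬ᵀ`) — by the duality `𝒬 ↔ 𝒬ᵀ`
the row sum is `−(𝒬 (Φ_m δ_{(α,x)}))_μ(z∕n) = −(compLinAvgAt r L m δ_{(α,x)})_μ(z∕n)` at a coarse `z`. -/
theorem comp_trK_phiK_bhK_inl_inr (x z : Fin (d + 1) → ℤ) (α μ : Fin (d + 1)) :
    comp (trK (phiK r L m)) (bhK (L ^ m)) x z (Sum.inl α) (Sum.inr μ) =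
      if Torus.proj (L ^ m) z = 0 then -(compLinAvgAt r L m (delta1 α x) μ (quo (L ^ m) z)) else 0 := by
  haveI : NeZero (L ^ m) := ⟨(pow_pos hL m).ne'⟩
  rw [comp_trK_phiK_inl_left]
  by_cases hz : Torus.proj (L ^ m) z = 0
  · have e : ∀ y, ∑ l : Fin (d + 1), corrPhi r L m (indR α x) l y * bhK (L ^ m) y z (Sum.inl l) (Sum.inr μ) =
        -(∑ l : Fin (d + 1), bhK (L ^ m) z y (Sum.inr μ) (Sum.inl l) * phiK r L m y x (Sum.inl l) (Sum.inl α)) := by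
      intro y
      rw [← Finset.sum_neg_distrib]
      refine Finset.sum_congr rfl fun l _ => ?_
      rw [bhK_inl_inr, if_pos hz, bhK_inr_inl, if_pos hz, contourSum_delta1_eq_contourSumAdj, phiK_inl_inl]
      ring
    simp_rw [e]
    have hf : fcol (phiK r L m) x (Sum.inl α) = corrPhi r L m (indR α x) := by
      funext l y; rw [fcol_apply, phiK_inl_inl]
    rw [tsum_neg, tsum_bhK_inr_inl (L ^ m) hz, hf, contourSum_corrPhi hL, indR_eq_delta1, if_pos hz]
  · have e : ∀ y, ∑ l : Fin (d + 1), corrPhi r L m (indR α x) l y * bhK (L ^ m) y z (Sum.inl l) (Sum.inr μ) = 0 := by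
      intro y
      refine Finset.sum_eq_zero fun l _ => ?_
      rw [bhK_inl_inr, if_neg hz, mul_zero]
    simp_rw [e]
    rw [tsum_zero, if_neg hz]

/-! ## §3 THE ENTRIES OF THE RE-LINEARISED BORDERED OPERATOR `Φ̂_mᵀ ∘ bhK (L^m) ∘ Φ̂_m` (= the row-D1 owner's `bhKcomp r L m`, defined by congruence in L4) -/

/-- [folklore] **FIELD–FIELD ENTRY: UNCHANGED** — `(Φ̂ᵀ ∘ bhK ∘ Φ̂)(x,z)_{κβ} = bhK(x,z)_{κβ}` = the (windowed) matrix of `d*d` (`curv_corrPhi`: `d*d` does not see the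
corrector; the matrix symmetry `curvAdj_curv_delta1_symm` carries it through `Φ̂ᵀ`). -/
theorem trK_phiK_bhK_phiK_inl_inl (x z : Fin (d + 1) → ℤ) (κ β : Fin (d + 1)) :
    comp (comp (trK (phiK r L m)) (bhK (L ^ m))) (phiK r L m) x z (Sum.inl κ) (Sum.inl β) = bhK (L ^ m) x z (Sum.inl κ) (Sum.inl β) := by
  rw [comp_comp_trK_phiK_bhK_phiK_inl r L m, comp_bhK_phiK_inl_inl r m hL, bhK_inl_inl_eq]

/-- [folklore] **MULTIPLIER–FIELD ENTRY: THE RE-LINEARISED BORDER** `[proj x = 0]·(compLinAvgAt r L m δ_{(β,z)})_κ(x∕n)` — the straight row `𝒬_n` of `bhK` becomes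
the COMPOSITE linearised averaging (L1 `contourSum_corrPhi`), same normalisation, multiplier legs at the coarse points. -/
theorem trK_phiK_bhK_phiK_inr_inl (x z : Fin (d + 1) → ℤ) (κ β : Fin (d + 1)) :
    comp (comp (trK (phiK r L m)) (bhK (L ^ m))) (phiK r L m) x z (Sum.inr κ) (Sum.inl β) =
      if Torus.proj (L ^ m) x = 0 then compLinAvgAt r L m (delta1 β z) κ (quo (L ^ m) x) else 0 := by
  rw [comp_comp_trK_phiK_bhK_phiK_inl r L m, comp_bhK_phiK_inr_inl r m hL]

/-- [folklore] **FIELD–MULTIPLIER ENTRY: MINUS THE TRANSPOSED RE-LINEARISED BORDER** `−[proj z = 0]·(compLinAvgAt r L m δ_{(α,x)})_μ(z∕n)` (the sign of `−𝒬ᵀ`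
in `bhK`; duality `contourSum_delta1_eq_contourSumAdj`). -/
theorem trK_phiK_bhK_phiK_inl_inr (x z : Fin (d + 1) → ℤ) (α μ : Fin (d + 1)) :
    comp (comp (trK (phiK r L m)) (bhK (L ^ m))) (phiK r L m) x z (Sum.inl α) (Sum.inr μ) =
      if Torus.proj (L ^ m) z = 0 then -(compLinAvgAt r L m (delta1 α x) μ (quo (L ^ m) z)) else 0 := by
  rw [comp_phiK_inr_right]
  exact comp_trK_phiK_bhK_inl_inr r m hL x z α μ

omit hL in
/-- [folklore] **MULTIPLIER–MULTIPLIER ENTRY: ZERO** (no gauge-fixing block). -/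
theorem trK_phiK_bhK_phiK_inr_inr (x z : Fin (d + 1) → ℤ) (μ₀ μ : Fin (d + 1)) :
    comp (comp (trK (phiK r L m)) (bhK (L ^ m))) (phiK r L m) x z (Sum.inr μ₀) (Sum.inr μ) = 0 := by
  rw [comp_phiK_inr_right, comp_trK_phiK_inr_left, bhK_inr_inr]

end Bordered

end

end Summit.QuantumFields.BalabanUV.Beta.CompositeCorrectorBordered
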